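import Mathlib

/-!
# Crux `TwistedDetRank.FermionicNormalForm` (stmt-ValiantsHypothesis-6283), line `registered` —
# stub `stub_cycleCountEqCard` (B2a): the number of `j`-cycles of `σ` as a pattern count

For a permutation `σ` of `Fin n` and any `j : ℕ`, the multiplicity `c_j(σ) = σ.cycleType.count j`
of `j` in the cycle type of `σ` (the number of `j`-cycles of `σ`) equals the number of
permutations `γ` of `Fin n` of cycle type `{j}` (i.e. `j`-cycles) that are *contained in* `σ`,
meaning that `σ` agrees with `γ` on the support of `γ`.  This rewrites `c_j` as a count over a
`σ`-independent index set (the `j`-cycles of `S_n`), which is what the fermionic normal form of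
the line needs in order to expand `∏_{j ∈ m} c_j(σ)` into indicators of partial permutations.

Proof: `σ.cycleType = σ.cycleFactorsFinset.val.map (card ∘ support)` (`Equiv.Perm.cycleType_def`),
so `count j` is the number of cycle factors of `σ` with support of size `j`
(`Multiset.count_map`); a permutation `γ` is a cycle factor of `σ` iff it is a cycle agreeing with
`σ` on its support (`Equiv.Perm.mem_cycleFactorsFinset_iff`), and `γ.cycleType = {j}` iff `γ` is
a cycle with `#γ.support = j` (`Equiv.Perm.IsCycle.cycleType`, `Equiv.Perm.card_cycleType_eq_one`).
Hence both sides count the same finset.  Mathlib only.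
-/

-- single-conjunct layout: Sub = Summit, duplicated namespace component intended
set_option linter.dupNamespace false

namespace Summit.ValiantsHypothesis.ValiantsHypothesis.Theorems.TwistedDetRankFermionicNormalForm

/-- A permutation has cycle type `{j}` iff it is a cycle whose support has `j` elements. -/
theorem cycleType_eq_singleton_iff {n j : ℕ} (γ : Equiv.Perm (Fin n)) :
    γ.cycleType = {j} ↔ γ.IsCycle ∧ γ.support.card = j := by
  constructor
  · intro h
    have hc : γ.IsCycle := by
      rw [← Equiv.Perm.card_cycleType_eq_one, h, Multiset.card_singleton]
    refine ⟨hc, ?_⟩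
    have h' := hc.cycleType
    rw [h, Multiset.singleton_inj] at h'
    exact h'.symm
  · rintro ⟨hc, rfl⟩
    exact hc.cycleType

/-- **Stub B2a** (`stub_cycleCountEqCard`): the number of `j`-cycles of `σ`,
`σ.cycleType.count j`, is the number of permutations `γ` of cycle type `{j}` contained in `σ`
(`σ i = γ i` for all `i` in the support of `γ`). -/
theorem stub_cycleCountEqCard :
    ∀ (n j : ℕ) (σ : Equiv.Perm (Fin n)),
      σ.cycleType.count j =
        (Finset.univ.filter fun γ : Equiv.Perm (Fin n) =>
          γ.cycleType = {j} ∧ ∀ i ∈ γ.support, σ i = γ i).card := by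
  intro n j σ
  rw [Equiv.Perm.cycleType_def, Multiset.count_map, ← Finset.filter_val, ← Finset.card_def]
  congr 1
  ext γ
  simp only [Finset.mem_filter, Finset.mem_univ, true_and, Function.comp_apply,
    Equiv.Perm.mem_cycleFactorsFinset_iff, cycleType_eq_singleton_iff]
  constructor
  · rintro ⟨⟨hc, h⟩, hj⟩
    exact ⟨⟨hc, hj.symm⟩, fun i hi => (h i hi).symm⟩
  · rintro ⟨⟨hc, hj⟩, h⟩
    exact ⟨⟨hc, fun i hi => (h i hi).symm⟩, hj.symm⟩

end Summit.ValiantsHypothesis.ValiantsHypothesis.Theorems.TwistedDetRankFermionicNormalForm
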